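import Summits.PneNP.PneNP.Theorems.ChebyshevTracialDesignLowDegreeHolds
import Summits.PneNP.PneNP.Theorems.ChebyshevTracialDesignTracialProfilePolynomial
import Summits.PneNP.PneNP.Theorems.ChebyshevTracialDesignProfileExtrapolation
import HarnessLib

/-!
# Cell pnp-psdrank, route `ChebyshevTracialDesign`: the SIGN cell BEYOND THE DESIGN DEGREE — a low-degree Gram cut factor of Johnson
# degree `k` with `D ≤ 2k ≤ c'` (ABOVE the exactness degree `D` of the design) is still priced at `≤ (2^{2k+1} + B_v)·r·√P_D`, at every
# dimension `r`, by reading the nonnegative virtual value at cutoff `2k` through the STABILITY OF EXTRAPOLATION from the real odd levels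
# (crux `TracialDecayExp20`, stmt-PneNP-19878)

Brick 89 (prover g17; MEMO-20 §2). The SIGN cell of the crux (brick 23 `…JuntaLowDegree.sum_levelWeight_trace_nonpos_of_lowDegree`,
unconditional since `Grigoriev2001_knapsackFormNonneg_holds`; matching-adapted form brick 88b) prices `X_U = A_U A_Uᵀ` with `A` of Johnson
degree `≤ k` at `≤ 0` — but only for `2k ≤ D`, the exactness degree of the design, because the per-matching level law `T(n/2;c,i)·P_M(c)`
(`lowdeg_sum_law`: `deg P_M ≤ 2k`, `P_M(0) ≥ 0` a sum of Grigoriev knapsack forms) is extrapolated to the virtual level `c = 0` by exactness.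
Grigoriev's knapsack positivity itself holds far beyond (`4k ≤ t`). This file removes the design degree as the obstruction, at the price
`2^{2k+1}·r·√P_D`:
* §1 **`abs_eval_zero_le_two_pow_mul`** — EXTRAPOLATION FROM THE ODD LEVELS IS `2^{K+1}`-STABLE: a real polynomial `Δ` of degree `≤ K` with
  `|Δ(2j+1)| ≤ τ` for `j = 0,…,K` has `|Δ(0)| ≤ 2^{K+1}·τ` (Lagrange interpolation at the nodes `1,3,…,2K+1`, Mathlib's `Lagrange.eq_interpolate`;
  the basis functions at `0` satisfy `|ℓ_i(0)| = Π_{j≠i}(2j+1)/(2|i−j|) ≤ Π_{j≠i}(j+1)/|i−j| = C(K+1,i+1)`, `abs_eval_zero_basis_le`).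
* §2 **`value_le_of_lowDegree_above_design`** — for `n` even, an exact design `(n, t = 2c'+1, T, D, B_v, C, w)` with `D ≤ 2k ≤ c'`, a cut factor
  `A` of Johnson degree `≤ k` with `A_U A_Uᵀ ⪯ I`, and ANY contraction-valued matching side `Y`:
  `Σ_{U,M} W(U,M)·tr(A_U A_Uᵀ Y_M) ≤ (2^{2k+1} + B_v)·r·√P_D`, `P_D = Π_{i≤D/2}(2i+1)/(n−2i)`.
  MECHANISM. Two polynomials describe the level profile `Φ(c) = Σ_{Q_c(t)} tr(A_U A_Uᵀ Y_M)`: (i) the EXACT one, `Φ(c) = |Q_c|·P♯(c)` at every odd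
  `c ≤ t`, `P♯ = |PM|⁻¹ Σ_M P_M` of degree `≤ 2k` with `P♯(0) ≥ 0` (Grigoriev, per matching); (ii) brick 20's TRACIAL PROFILE POLYNOMIAL `P` of
  degree `≤ D` (`…TracialProfilePolynomial.tracial_profile_polynomial_of_contractions`, contractions only, no tightness), with
  `|Φ(c) − |Q_c|·P(c)| ≤ |Q_c|·r√P_D` at EVERY odd level `c ≤ t` — not only at the design levels. Hence `|P♯ − P| ≤ r√P_D` at the `2k+1` odd
  nodes `1,…,4k+1 ≤ t`, so `|P♯(0) − P(0)| ≤ 2^{2k+1}·r√P_D` (§1); exactness prices `P` at `−P(0)`, and `P♯ − P` costs at most `B_v·r√P_D` on the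
  design levels: `value = Σ_c w_c P♯(c) ≤ −P♯(0) + (2^{2k+1} + B_v)·r√P_D ≤ (2^{2k+1} + B_v)·r√P_D`.
  RANGE. Useful as long as `2^{2k}·√P_D ≪ e^{−aD}`, i.e. up to `2k ≈ D·ln(n/16D)/(4 ln 2)` — the SIGN cell extends from Gram degree `D/2` to
  `≈ 0.18·D·ln n`, r-uniformly; beyond that the virtual value is no longer legible through a degree-`D` design (MEMO-20 §2 for the discussion:
  the design degree is not a wall for SIGN-type arguments, the wall is where the extrapolation constant meets the tail).
[cite: Grigoriev2001, Lemma 1.4 (PDF p. 8)] [cite: Rothvoss2017, §2 (PDF p. 6)] [cite: GriblingDelaatLaurent2019, §5]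
[cite: CoppersmithRivlin1992, Thm. (p. 970)]
Stature: support/instrument (kernel lane, no defs, axioms standard). WHAT THIS IS NOT: nothing on the thin/spread cells of the crux, no proof or
refutation of `TracialDecayExp20`, nothing on psd rank of P_PM(K_n), no P-vs-NP content. Supports stmt-PneNP-19878.
-/

set_option linter.dupNamespace false -- `Summit.PneNP.PneNP.…`: summit = sub-problem (D-0017)

noncomputable section

namespace Summit.PneNP.PneNP.Theorems.ChebyshevTracialDesignExtrapolatedSign

open Finset Matrix Polynomial Literature.Barriers.PneNP Literature.Combinatorics.SimpleGraph.CycleSpace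
open Literature.Computability.Complexity Literature.Combinatorics.Optimization
open Summit.PneNP.PneNP.Theorems.ChebyshevTracialDesignJunta
open Summit.PneNP.PneNP.Theorems.ChebyshevTracialDesignTracialProfilePolynomial
open Summit.PneNP.PneNP.Theorems.ChebyshevTracialDesignProfileExtrapolation (value_eq_level_sums)
open Summit.PneNP.PneNP.Theorems.ChebyshevTracialDesignProfilePolynomial (card_pmatch_pos)
open scoped MatrixOrder

variable {n : ℕ}

/-! ### §1 Extrapolation from the odd nodes `1, 3, …, 2K+1` to `0` is `2^{K+1}`-stable -/

/-- `(i+1)·Π_{j ∈ (range (K+1)) \ {i}} (j+1) = (K+1)!`. [folklore] -/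
theorem succ_mul_prod_erase_succ (K i : ℕ) (hi : i ∈ range (K + 1)) :
    ((i : ℝ) + 1) * ∏ j ∈ (range (K + 1)).erase i, ((j : ℝ) + 1) = ((K + 1).factorial : ℝ) := by
  rw [mul_prod_erase (range (K + 1)) (fun j => (j : ℝ) + 1) hi]
  have h := Finset.prod_range_add_one_eq_factorial (K + 1)
  exact_mod_cast h

/-- `Π_{j ∈ (range (K+1)) \ {i}} |i − j| = i!·(K − i)!` for `i ≤ K`. [folklore] -/
theorem prod_erase_abs_sub (K i : ℕ) (hi : i ≤ K) :
    ∏ j ∈ (range (K + 1)).erase i, |(i : ℝ) - j| = ((i.factorial * (K - i).factorial : ℕ) : ℝ) := by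
  classical
  set g : ℕ → ℝ := fun j => if j = i then 1 else |(i : ℝ) - j| with hg
  have hmem : i ∈ range (K + 1) := mem_range.2 (show i < K + 1 by omega)
  have hgi : g i = 1 := by rw [hg]; simp
  have hcongr : ∏ j ∈ (range (K + 1)).erase i, g j = ∏ j ∈ (range (K + 1)).erase i, |(i : ℝ) - j| :=
    prod_congr rfl fun j hj => by rw [hg]; simp only; rw [if_neg (ne_of_mem_erase hj)]
  have h1 : ∏ j ∈ (range (K + 1)).erase i, |(i : ℝ) - j| = ∏ j ∈ range (K + 1), g j := by
    rw [← mul_prod_erase _ g hmem, hgi, one_mul, hcongr]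
  rw [h1, ← prod_range_mul_prod_Ico g (show i ≤ K + 1 by omega),
    prod_eq_prod_Ico_succ_bot (show i < K + 1 by omega)]
  have h2 : ∏ j ∈ range i, g j = (i.factorial : ℝ) := by
    have h3 : ∏ j ∈ range i, g j = ∏ j ∈ range i, (((i - 1 - j : ℕ) : ℝ) + 1) := by
      refine prod_congr rfl fun j hj => ?_
      have hji := mem_range.1 hj
      rw [hg]; simp only
      rw [if_neg (by omega)]
      have : (i : ℝ) - j = ((i - 1 - j : ℕ) : ℝ) + 1 := by
        rw [Nat.cast_sub (by omega), Nat.cast_sub (by omega)]; push_cast; ring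
      rw [this, abs_of_pos (by positivity)]
    rw [h3, prod_range_reflect (fun j => ((j : ℕ) : ℝ) + 1) i]
    exact_mod_cast prod_range_add_one_eq_factorial i
  have h4 : ∏ j ∈ Ico (i + 1) (K + 1), g j = ((K - i).factorial : ℝ) := by
    rw [prod_Ico_eq_prod_range]
    have h5 : ∏ k ∈ range (K + 1 - (i + 1)), g (i + 1 + k) = ∏ k ∈ range (K - i), ((k : ℝ) + 1) := by
      rw [show K + 1 - (i + 1) = K - i by omega]
      refine prod_congr rfl fun k _ => ?_
      rw [hg]; simp only
      rw [if_neg (by omega)]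
      push_cast
      rw [show (i : ℝ) - (i + 1 + k) = -((k : ℝ) + 1) by ring, abs_neg, abs_of_pos (by positivity)]
    rw [h5]
    exact_mod_cast prod_range_add_one_eq_factorial (K - i)
  rw [h2, hgi, one_mul, h4]
  push_cast; ring

/-- The Lagrange basis functions for the odd nodes `1, 3, …, 2K+1`, evaluated at `0`: `|ℓ_i(0)| = Π_{j≠i}(2j+1)/(2|i−j|) ≤ C(K+1, i+1)`.
[folklore] -/
theorem abs_eval_zero_basis_le (K i : ℕ) (hi : i ∈ range (K + 1)) :
    |(Lagrange.basis (range (K + 1)) (fun j : ℕ => (2 * (j : ℝ) + 1)) i).eval 0| ≤ ((K + 1).choose (i + 1) : ℝ) := by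
  classical
  have hiK : i ≤ K := by have := mem_range.1 hi; omega
  rw [Lagrange.basis, eval_prod, abs_prod]
  have hterm : ∀ j ∈ (range (K + 1)).erase i,
      |(Lagrange.basisDivisor (2 * (i : ℝ) + 1) (2 * (j : ℝ) + 1)).eval 0| ≤ ((j : ℝ) + 1) / |(i : ℝ) - j| := by
    intro j hj
    have hij : j ≠ i := ne_of_mem_erase hj
    have hij' : (i : ℝ) - j ≠ 0 := by
      rw [sub_ne_zero]; exact_mod_cast hij.symm
    rw [Lagrange.basisDivisor, eval_mul, eval_C, eval_sub, eval_X, eval_C, abs_mul, abs_inv,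
      show 2 * (i : ℝ) + 1 - (2 * j + 1) = 2 * ((i : ℝ) - j) by ring, abs_mul, abs_two, zero_sub, abs_neg,
      abs_of_pos (show (0 : ℝ) < 2 * j + 1 by positivity)]
    rw [div_eq_mul_inv, mul_comm]
    have hpos : 0 < |(i : ℝ) - j| := abs_pos.2 hij'
    rw [mul_inv, ← mul_assoc]
    exact mul_le_mul_of_nonneg_right (by linarith) (inv_nonneg.2 hpos.le)
  have hnn : ∀ j ∈ (range (K + 1)).erase i, 0 ≤ |(Lagrange.basisDivisor (2 * (i : ℝ) + 1) (2 * (j : ℝ) + 1)).eval 0| :=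
    fun j _ => abs_nonneg _
  refine (prod_le_prod hnn hterm).trans ?_
  rw [prod_div_distrib, prod_erase_abs_sub K i hiK]
  have hprod := succ_mul_prod_erase_succ K i hi
  have hi1 : (0 : ℝ) < (i : ℝ) + 1 := by positivity
  have hfac : (((K + 1).choose (i + 1) : ℕ) : ℝ) * (((i + 1).factorial : ℕ) : ℝ) * (((K - i).factorial : ℕ) : ℝ) =
      (((K + 1).factorial : ℕ) : ℝ) := by
    have h := Nat.choose_mul_factorial_mul_factorial (show i + 1 ≤ K + 1 by omega)
    rw [show K + 1 - (i + 1) = K - i by omega] at h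
    exact_mod_cast h
  have hden : (0 : ℝ) < ((i.factorial * (K - i).factorial : ℕ) : ℝ) := by positivity
  rw [div_le_iff₀ hden]
  have hkey : ∏ j ∈ (range (K + 1)).erase i, ((j : ℝ) + 1) =
      (((K + 1).choose (i + 1) : ℕ) : ℝ) * ((i.factorial * (K - i).factorial : ℕ) : ℝ) := by
    have h1 : ((i : ℝ) + 1) * ∏ j ∈ (range (K + 1)).erase i, ((j : ℝ) + 1) =
        ((i : ℝ) + 1) * ((((K + 1).choose (i + 1) : ℕ) : ℝ) * ((i.factorial * (K - i).factorial : ℕ) : ℝ)) := by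
      rw [hprod, ← hfac]
      push_cast
      rw [Nat.factorial_succ]
      push_cast
      ring
    exact mul_left_cancel₀ hi1.ne' h1
  rw [hkey]

/-- **Extrapolation from the odd nodes is `2^{K+1}`-stable.** If `Δ ∈ ℝ[x]` has degree `≤ K` and `|Δ(2j+1)| ≤ τ` for `j = 0, …, K`, then
`|Δ(0)| ≤ 2^{K+1}·τ` (`Δ = Σ_i Δ(2i+1)·ℓ_i` by Lagrange interpolation; `Σ_i |ℓ_i(0)| ≤ Σ_i C(K+1,i+1) ≤ 2^{K+1}`). This is what lets an exact design
of degree `D` read a virtual value at a cutoff `K > D`: it controls the profile at ALL odd levels, not just at its own nodes.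
[cite: CoppersmithRivlin1992, Thm. (p. 970)] -/
theorem abs_eval_zero_le_two_pow_mul (K : ℕ) (Δ : Polynomial ℝ) (hdeg : Δ.natDegree ≤ K) {τ : ℝ} (hτ : 0 ≤ τ)
    (hbd : ∀ j, j ≤ K → |Δ.eval (2 * (j : ℝ) + 1)| ≤ τ) : |Δ.eval 0| ≤ 2 ^ (K + 1) * τ := by
  classical
  set s : Finset ℕ := range (K + 1) with hs
  set v : ℕ → ℝ := fun j => 2 * (j : ℝ) + 1 with hv
  have hvs : Set.InjOn v s := by
    intro a _ b _ hab
    have : (2 * (a : ℝ) + 1) = 2 * (b : ℝ) + 1 := hab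
    exact_mod_cast (by linarith : (a : ℝ) = b)
  have hdeg' : Δ.degree < s.card := by
    rw [hs, card_range]
    exact lt_of_le_of_lt (degree_le_of_natDegree_le hdeg) (by exact_mod_cast Nat.lt_succ_self K)
  have heq := Lagrange.eq_interpolate hvs hdeg'
  have heval : Δ.eval 0 = ∑ i ∈ s, Δ.eval (v i) * (Lagrange.basis s v i).eval 0 := by
    conv_lhs => rw [heq]
    rw [Lagrange.interpolate_apply, eval_finsetSum]
    exact sum_congr rfl fun i _ => by rw [eval_mul, eval_C]
  rw [heval]
  calc |∑ i ∈ s, Δ.eval (v i) * (Lagrange.basis s v i).eval 0|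
      ≤ ∑ i ∈ s, |Δ.eval (v i) * (Lagrange.basis s v i).eval 0| := abs_sum_le_sum_abs _ _
    _ ≤ ∑ i ∈ s, τ * ((K + 1).choose (i + 1) : ℝ) := by
        refine sum_le_sum fun i hi => ?_
        rw [abs_mul]
        exact mul_le_mul (hbd i (by have := mem_range.1 hi; omega)) (abs_eval_zero_basis_le K i hi) (abs_nonneg _) hτ
    _ = τ * ∑ i ∈ range (K + 1), ((K + 1).choose (i + 1) : ℝ) := by rw [← mul_sum]
    _ ≤ τ * 2 ^ (K + 1) := by
        refine mul_le_mul_of_nonneg_left ?_ hτ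
        have h1 : ∑ i ∈ range (K + 1), ((K + 1).choose (i + 1) : ℝ) ≤ ∑ i ∈ range (K + 2), ((K + 1).choose i : ℝ) := by
          rw [sum_range_succ' (fun i => ((K + 1).choose i : ℝ)) (K + 1)]
          simp
        have h2 : ∑ i ∈ range (K + 2), ((K + 1).choose i : ℝ) = 2 ^ (K + 1) := by
          have := Nat.sum_range_choose (K + 1)
          exact_mod_cast this
        linarith
    _ = 2 ^ (K + 1) * τ := mul_comm _ _

/-! ### §2 Low-degree Gram cut factors above the design degree -/

/-- **THE SIGN CELL ABOVE THE DESIGN DEGREE.** Let `n` be even, `(n, t = 2c'+1, T, D, B_v, C, w)` an exact design, `A : OddSet n → ℝ^{r×m}` a cut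
factor of Johnson degree `≤ k` (`IsLowDegreeU n k A`) with `D ≤ 2k` and `2k ≤ c'` (so the `2k+1` odd nodes `1,…,4k+1` are real levels `≤ t`),
`X_U = A_U A_Uᵀ ⪯ I`, and `Y` any family of psd contractions. Then
`Σ_{U,M} levelWeight(U,M)·tr(A_U A_Uᵀ Y_M) ≤ (2^{2k+1} + B_v)·r·√(Π_{i≤D/2}(2i+1)/(n−2i))`.
Per matching, `lowdeg_sum_law` gives the exact level law `T(n/2;c,i)·P_M(c)`, `deg P_M ≤ 2k`, `P_M(0) ≥ 0` (Grigoriev's knapsack Lemma 1.4, range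
`4k ≤ t`); averaged, `Φ(c) = |Q_c(t)|·P♯(c)` exactly with `P♯(0) ≥ 0`. Brick 20's tracial profile polynomial `P` (degree `≤ D`) is
`r√P_D`-close to `P♯` at every odd level, hence `2^{2k+1} r√P_D`-close at the virtual level (§1), and the design prices `P` exactly.
[cite: Grigoriev2001, Lemma 1.4 (PDF p. 8)] [cite: Rothvoss2017, §2 (PDF p. 6)] [cite: GriblingDelaatLaurent2019, §5]
[cite: CoppersmithRivlin1992, Thm. (p. 970)] -/
theorem value_le_of_lowDegree_above_design {c' T D : ℕ} {Bv : ℝ} {C : Finset ℕ} {w : ℕ → ℝ} (hn : Even n)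
    (hdes : IsExactDesign n (2 * c' + 1) T D Bv C w) {r m k : ℕ} (hDk : D ≤ 2 * k) (hkc : 2 * k ≤ c')
    (A : OddSet n → Matrix (Fin r) (Fin m) ℝ) (hA : IsLowDegreeU n k A) (hA1 : ∀ U, (1 - A U * (A U)ᵀ).PosSemidef)
    (Y : PMatch n → Matrix (Fin r) (Fin r) ℝ) (hY : ∀ M, (Y M).PosSemidef ∧ (1 - Y M).PosSemidef) :
    ∑ U, ∑ M, levelWeight n (2 * c' + 1) C w U M * (A U * (A U)ᵀ * Y M).trace ≤
      (2 ^ (2 * k + 1) + Bv) * ((r : ℝ) * Real.sqrt (∏ i ∈ range (D / 2 + 1), ((2 * i + 1 : ℝ) / ((n : ℝ) - 2 * i)))) := by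
  classical
  have hG : Grigoriev2001_knapsackFormNonneg := Grigoriev2001_knapsackFormNonneg_holds
  obtain ⟨htodd, htn, hTt, hC, -, hexact, hBv⟩ := hdes
  set t := 2 * c' + 1 with htdef
  have h4k : 4 * k ≤ t := by omega
  -- coefficients of the low-degree entries
  have hα' : ∀ a j, ∃ c : {A' : Finset (Fin n) // A'.card ≤ k} → ℝ,
      ∑ A', c A' • (fun U : OddSet n => if A'.1 ⊆ U.1 then (1 : ℝ) else 0) = fun U => A U a j :=
    fun a j => (Submodule.mem_span_range_iff_exists_fun ℝ).1 (hA a j)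
  choose α hα using hα'
  have hAeval : ∀ (U : OddSet n) a j,
      A U a j = ∑ A' : {A' : Finset (Fin n) // A'.card ≤ k}, α a j A' * (if A'.1 ⊆ U.1 then (1 : ℝ) else 0) := by
    intro U a j
    have := congrFun (hα a j) U
    rw [Finset.sum_apply] at this
    rw [← this]
    exact sum_congr rfl fun A' _ => by rw [Pi.smul_apply, smul_eq_mul]
  have hXpsd : ∀ U : OddSet n, (A U * (A U)ᵀ).PosSemidef := fun U => by
    simpa [Matrix.conjTranspose_eq_transpose_of_trivial] using Matrix.posSemidef_self_mul_conjTranspose (A U)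
  have hX : ∀ U : OddSet n, (A U * (A U)ᵀ).PosSemidef ∧ (1 - A U * (A U)ᵀ).PosSemidef := fun U => ⟨hXpsd U, hA1 U⟩
  -- Step 1: per matching, the exact polynomial level law of degree ≤ 2k with nonnegative virtual value
  have hN : ∀ M : PMatch n, M.1.card = n / 2 := fun M => by have := two_mul_card_pmatch M; omega
  have hP : ∀ M : PMatch n, ∃ P : Polynomial ℝ, P.natDegree ≤ 2 * k ∧ 0 ≤ P.eval 0 ∧ ∀ c i : ℕ, c + 2 * i = t →
      ∑ U : OddSet n, (if U.1.card = t ∧ cc U M = c then (A U * (A U)ᵀ * Y M).trace else 0) =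
        (((n / 2).choose (c + i) * (c + i).choose i * 2 ^ c : ℕ) : ℝ) * P.eval (c : ℝ) := by
    intro M
    have hMt : t + 1 ≤ M.1.card := by have := two_mul_card_pmatch M; omega
    have hk : 2 * k ≤ M.1.card := by omega
    have hr₁ : (k : ℝ) - 1 < (t : ℝ) / 2 := by
      have : (4 : ℝ) * k ≤ t := by exact_mod_cast h4k
      linarith
    have hr₂ : (t : ℝ) / 2 < (M.1.card : ℝ) - k + 1 := by
      have h1 : (4 : ℝ) * k ≤ t := by exact_mod_cast h4k
      have h2 : (t : ℝ) + 1 ≤ M.1.card := by exact_mod_cast hMt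
      linarith
    obtain ⟨P, hPdeg, hP0, hPval⟩ := lowdeg_sum_law hG M hk hr₁ hr₂ α (Y M) (hY M).1
    refine ⟨P, hPdeg, hP0, fun c i hci => ?_⟩
    rw [sum_oddSet_level_eq M hci (fun U => A U * (A U)ᵀ) Y, ← hN M, ← hPval c i hci]
    refine sum_congr rfl fun U' hU' => ?_
    have hodd : Odd U'.card := by
      obtain ⟨-, hc, hi⟩ := mem_filter.1 hU'
      have h := card_eq_cr_add_two_mul_in M.2 (subset_univ U')
      rw [hc, hi, hci] at h
      exact h ▸ htodd
    rw [dif_pos hodd, trace_mul_transpose_mul_eq]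
    refine sum_congr rfl fun j _ => sum_congr rfl fun a _ => sum_congr rfl fun b _ => ?_
    rw [hAeval ⟨U', hodd⟩ a j, hAeval ⟨U', hodd⟩ b j]
  choose P hPdeg hP0 hPval using hP
  -- Step 2: the size of the level classes `|Q_c(t)| = |PM|·T(n/2; c, i)`, positive at every odd level `c ≤ t`
  have hQ : ∀ c i : ℕ, c + 2 * i = t → ((Qset n t c).card : ℝ) =
      (Fintype.card (PMatch n) : ℝ) * (((n / 2).choose (c + i) * (c + i).choose i * 2 ^ c : ℕ) : ℝ) := by
    intro c i hci
    have e1 : ((Qset n t c).card : ℝ) =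
        ∑ M : PMatch n, ∑ U : OddSet n, (if U.1.card = t ∧ cc U M = c then (1 : ℝ) else 0) := by
      rw [Qset, Finset.card_filter, Nat.cast_sum, Fintype.sum_prod_type, sum_comm]
      refine sum_congr rfl fun M _ => sum_congr rfl fun U _ => ?_
      split_ifs <;> simp
    have e2 : ∀ M : PMatch n, ∑ U : OddSet n, (if U.1.card = t ∧ cc U M = c then (1 : ℝ) else 0) =
        (((n / 2).choose (c + i) * (c + i).choose i * 2 ^ c : ℕ) : ℝ) := by
      intro M
      have key := sum_oddSet_level_eq M hci (r := 1) (fun _ => 1) (fun _ => 1)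
      simp only [Matrix.mul_one, trace_one, Fintype.card_fin, Nat.cast_one, dite_eq_ite] at key
      rw [key]
      have hodd : ∀ U' ∈ (univ : Finset (Fin n)).powerset.filter (fun U' =>
          (M.1.filter fun e => cutCount U' e = 1).card = c ∧ (M.1.filter fun e => cutCount U' e = 2).card = i),
          (if Odd U'.card then (1 : ℝ) else 0) = 1 := by
        intro U' hU'
        rw [mem_filter] at hU'
        have hc := card_eq_cr_add_two_mul_in M.2 (subset_univ U')
        rw [hU'.2.1, hU'.2.2, hci] at hc
        rw [if_pos (hc ▸ htodd)]
      rw [sum_congr rfl hodd, sum_const, nsmul_eq_mul, mul_one, card_filter_cr_in_eq M.2, hN M]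
    rw [e1, Fintype.sum_congr _ _ e2, sum_const, card_univ, nsmul_eq_mul]
  have hPm : (0 : ℝ) < Fintype.card (PMatch n) := by exact_mod_cast card_pmatch_pos hn
  have hTpos : ∀ c i : ℕ, c + 2 * i = t → (0 : ℝ) < (((n / 2).choose (c + i) * (c + i).choose i * 2 ^ c : ℕ) : ℝ) := by
    intro c i hci
    have h1 : c + i ≤ n / 2 := by omega
    have := Nat.choose_pos h1
    have := Nat.choose_pos (show i ≤ c + i by omega)
    positivity
  -- the averaged exact polynomial `P♯ = |PM|⁻¹·Σ_M P_M`
  set Psharp : Polynomial ℝ := Polynomial.C ((Fintype.card (PMatch n) : ℝ)⁻¹) * ∑ M : PMatch n, P M with hPsharp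
  have hPsharp_deg : Psharp.natDegree ≤ 2 * k := by
    refine (natDegree_C_mul_le _ _).trans ?_
    exact Polynomial.natDegree_sum_le_of_forall_le _ _ fun M _ => hPdeg M
  have hPsharp_eval : ∀ x : ℝ, Psharp.eval x = (Fintype.card (PMatch n) : ℝ)⁻¹ * ∑ M : PMatch n, (P M).eval x := fun x => by
    rw [hPsharp, eval_mul, eval_C, eval_finsetSum]
  have hPsharp0 : 0 ≤ Psharp.eval 0 := by
    rw [hPsharp_eval]
    exact mul_nonneg (inv_nonneg.2 hPm.le) (sum_nonneg fun M _ => hP0 M)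
  -- the level profile and its exact law `Φ(c) = |Q_c|·P♯(c)` at every odd level `c ≤ t`
  set Φ : ℕ → ℝ := fun c => ∑ q ∈ Qset n t c, (A q.1 * (A q.1)ᵀ * Y q.2).trace with hΦ
  have hΦlaw : ∀ mm : ℕ, mm ≤ c' → Φ (2 * mm + 1) = ((Qset n t (2 * mm + 1)).card : ℝ) * Psharp.eval ((2 * mm + 1 : ℕ) : ℝ) := by
    intro mm hmm
    have hci : (2 * mm + 1) + 2 * (c' - mm) = t := by omega
    rw [hΦ]; simp only
    rw [← level_sum_eq_sum_Qset t (2 * mm + 1) (fun U M => (A U * (A U)ᵀ * Y M).trace),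
      sum_congr rfl fun M _ => hPval M (2 * mm + 1) (c' - mm) hci, ← mul_sum, hQ _ _ hci, hPsharp_eval]
    field_simp
  -- Step 3: brick 20's degree-D profile polynomial, `r√P_D`-close at every odd level
  obtain ⟨p, PD, -, -, hPDdeg, -, hlev⟩ :=
    tracial_profile_polynomial_of_contractions hn htn (by omega : D ≤ 2 * c') (fun U => A U * (A U)ᵀ) Y hX hY
  set τ : ℝ := (r : ℝ) * Real.sqrt (∏ i ∈ range (D / 2 + 1), ((2 * i + 1 : ℝ) / ((n : ℝ) - 2 * i))) with hτ
  have hτ0 : 0 ≤ τ := by positivity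
  have hclose : ∀ mm : ℕ, mm ≤ c' → |Psharp.eval ((2 * mm + 1 : ℕ) : ℝ) - PD.eval ((2 * mm + 1 : ℕ) : ℝ)| ≤ τ := by
    intro mm hmm
    have hci : (2 * mm + 1) + 2 * (c' - mm) = t := by omega
    have hQpos : (0 : ℝ) < ((Qset n t (2 * mm + 1)).card : ℝ) := by
      rw [hQ _ _ hci]; exact mul_pos hPm (hTpos _ _ hci)
    have h1 := hlev mm hmm
    have h2 : ∑ q ∈ Qset n t (2 * mm + 1), ((fun U => A U * (A U)ᵀ) q.1 * Y q.2).trace = Φ (2 * mm + 1) := rfl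
    rw [h2, hΦlaw mm hmm, ← mul_sub, abs_mul, Nat.abs_cast] at h1
    exact le_of_mul_le_mul_left h1 hQpos
  -- Step 4: extrapolate the difference (degree ≤ 2k) from the odd nodes `1,…,4k+1`
  set Δ : Polynomial ℝ := Psharp - PD with hΔ
  have hΔdeg : Δ.natDegree ≤ 2 * k := (natDegree_sub_le _ _).trans (max_le hPsharp_deg (hPDdeg.trans hDk))
  have hΔ0 : |Δ.eval 0| ≤ 2 ^ (2 * k + 1) * τ := by
    refine abs_eval_zero_le_two_pow_mul (2 * k) Δ hΔdeg hτ0 fun j hj => ?_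
    have h := hclose j (by omega)
    rw [hΔ, eval_sub]
    push_cast at h ⊢
    exact h
  -- Step 5: the design value through `P♯`, priced via `PD` (exactness) and the closeness on the design levels
  have hval : ∑ U, ∑ M, levelWeight n t C w U M * (A U * (A U)ᵀ * Y M).trace = ∑ c ∈ C, w c * Psharp.eval (c : ℝ) := by
    rw [value_eq_level_sums]
    refine sum_congr rfl fun c hc => ?_
    obtain ⟨⟨mm, hmm⟩, -, hcT, hne⟩ := hC c hc
    have hmmc : mm ≤ c' := by omega
    have hQ0 : ((Qset n t c).card : ℝ) ≠ 0 := by exact_mod_cast (card_pos.2 hne).ne'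
    rw [level_sum_eq_sum_Qset, show ∑ q ∈ Qset n t c, (A q.1 * (A q.1)ᵀ * Y q.2).trace = Φ c from rfl, hmm, hΦlaw mm hmmc]
    have : ((2 * mm + 1 : ℕ) : ℝ) = ((2 * mm + 1 : ℕ) : ℝ) := rfl
    field_simp
  rw [hval]
  have hsplit : ∑ c ∈ C, w c * Psharp.eval (c : ℝ) = ∑ c ∈ C, w c * PD.eval (c : ℝ) + ∑ c ∈ C, w c * Δ.eval (c : ℝ) := by
    rw [← sum_add_distrib]
    exact sum_congr rfl fun c _ => by rw [hΔ, eval_sub]; ring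
  have hexD : ∑ c ∈ C, w c * PD.eval (c : ℝ) = -PD.eval 0 := hexact PD hPDdeg
  have herr : ∑ c ∈ C, w c * Δ.eval (c : ℝ) ≤ Bv * τ := by
    calc ∑ c ∈ C, w c * Δ.eval (c : ℝ) ≤ ∑ c ∈ C, |w c| * τ := by
          refine sum_le_sum fun c hc => ?_
          obtain ⟨⟨mm, hmm⟩, -, hcT, -⟩ := hC c hc
          have h := hclose mm (by omega)
          have h' : |Δ.eval (c : ℝ)| ≤ τ := by
            rw [hΔ, eval_sub, hmm]; exact h
          calc w c * Δ.eval (c : ℝ) ≤ |w c * Δ.eval (c : ℝ)| := le_abs_self _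
            _ = |w c| * |Δ.eval (c : ℝ)| := abs_mul _ _
            _ ≤ |w c| * τ := mul_le_mul_of_nonneg_left h' (abs_nonneg _)
      _ = (∑ c ∈ C, |w c|) * τ := by rw [sum_mul]
      _ ≤ Bv * τ := mul_le_mul_of_nonneg_right hBv hτ0
  have hPD0 : -PD.eval 0 = -Psharp.eval 0 + Δ.eval 0 := by rw [hΔ, eval_sub]; ring
  have hΔ0' : Δ.eval 0 ≤ 2 ^ (2 * k + 1) * τ := (le_abs_self _).trans hΔ0
  rw [hsplit, hexD, hPD0]
  nlinarith [hPsharp0, herr, hΔ0']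

end Summit.PneNP.PneNP.Theorems.ChebyshevTracialDesignExtrapolatedSign

end
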